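import Summits.BirchSwinnertonDyer.BirchSwinnertonDyer.Theorems.SylvesterTwoHeegnerIndexCMNormForm
import Literature.NumberTheory.EllipticCurves.LeadingTermHeegnerProofs
import HarnessLib

/-!
# Route `SylvesterTwoHeegnerIndex` (rung K7t), item 19580 `TwoAdicPairHSY`: `2`-PRIMITIVE DESCENT
# for the `ℤ[ω]`-line of a non-halvable point (the non-negativity layer, part 1: pure algebra)

Cell `bsd-cm`, seat `bsd-cm-two` (prover-bsd-cm-two-g5-0; planner ruling D104 (ii): x1b GEN 48 owns
the PARITY layer `…CMNormForm.lean` / `…TwoInertParity.lean` + the Hu–Shu–Yin (bsd) fact, this seat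
owns NON-NEGATIVITY + ASSEMBLY). PARTITION (D55): CornerF at `p = 2` (B14/O12) × 𝒞_HSY × `p = 2`
— types-the-object-of (kernel helper `--supports stmt-BirchSwinnertonDyer-19580`); closes no cell
and no item; BSD is not claimed.

SETTING (x1b's interface, by name): a Weierstrass equation `W` in Mordell form
(`a₁ = a₂ = a₃ = a₄ = 0`) over a field containing `ω` with `ω² + ω + 1 = 0`, and ANY self-map `θ` of
`W(F)` with `θ 𝒪 = 𝒪`, `θ (x, y) = (ωx, y)` (hypotheses `hθ0`, `hθ`;
`SylvesterTwoCMNormForm.exists_omegaRot`). Everything below is PROVED (no named fact, no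
definition):

* §1 `θ` is ADDITIVE and preserves torsion (it agrees pointwise with the additive `exists_omegaRot`),
  and `θ(θP) = −P − θP`.
* §2 **The mod-`2` UNIT TRICK** (`2` is inert in `ℤ[ω]`, so `a + bω ∉ 2ℤ[ω]` is a unit modulo `2`):
  if `a·P + b·θP ∈ 2·W(F) + tors` with `a, b` not both even, then `P ∈ 2·W(F) + tors`. No rank,
  Mordell–Weil, or PID input.
* §3 **`2`-PRIMITIVE DESCENT**: if `P ∉ 2·W(F) + tors` and `n·Y = a·P + b·θP + T` (`n ≠ 0`, `T`
  torsion) — i.e. `Y = ((a + bω)/n) ⊗ P` in `W(F) ⊗ ℚ` — then `0 ≤ ord₂((a² − ab + b²)/n²)`: the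
  `ℤ₂[ω]`-coordinate of `Y` along `P` is `2`-INTEGRAL (strong induction on `|n|`, halving through
  §2 and «`2X` torsion ⇒ `X` torsion»). This is the weak, kernel form of MEMO bsd-cm-two §15.1
  (odd-index lemma) that the crux needs.

Sequel: `…GeneratorNotHalvable.lean` (the hypothesis `P ∉ 2·W(K) + tors` for Hu–Shu–Yin's generator,
`E_p(K)[2] = 0`, and the two residue-class layers of 19580).

## References
* Y. Hu, J. Shu, H. Yin, Trans. AMS 372 (2019) = arXiv:1708.05266, pp. 4, 8.
* J. H. Silverman, *The Arithmetic of Elliptic Curves*, GTM 106, VIII.9.3.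
* MEMO bsd-cm-two v2.6 (HOME/frozen/MEMO-bsd-cm-two.v2.6.58efc9f6d4c526f2.md) §15.1.
-/

set_option autoImplicit false
-- the Summit-side namespace `Summit.BirchSwinnertonDyer.BirchSwinnertonDyer.…` (summit = problem) is mandated by D-0017
set_option linter.dupNamespace false

noncomputable section

open scoped Classical

open WeierstrassCurve WeierstrassCurve.Affine WeierstrassCurve.Affine.Point
  Summit.BirchSwinnertonDyer.BirchSwinnertonDyer.Theorems.SylvesterTwoCMNormForm

namespace Summit.BirchSwinnertonDyer.BirchSwinnertonDyer.Theorems.SylvesterTwoNonneg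

/-! ## §1 `θ` is additive, preserves torsion, and `θθ = −1 − θ` -/

section Theta

variable {F : Type*} [Field F] {W : WeierstrassCurve F} {ω : F}
variable (hω : ω ^ 2 + ω + 1 = 0) (h1 : W.a₁ = 0) (h2 : W.a₂ = 0) (h3 : W.a₃ = 0) (h4 : W.a₄ = 0)
variable {θ : W.toAffine.Point → W.toAffine.Point} (hθ0 : θ 0 = 0)
  (hθ : ∀ (x y : F) (h : W.toAffine.Nonsingular x y),
    θ (.some x y h) = .some (ω * x) y (nonsingular_omega_mul hω h1 h2 h3 h4 h))

include hω h1 h2 h3 h4 hθ0 hθ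

/-- `θ` is ADDITIVE: it agrees on every point with the additive automorphism of
`SylvesterTwoCMNormForm.exists_omegaRot` (both send `𝒪 ↦ 𝒪`, `(x, y) ↦ (ωx, y)`). [folklore] -/
theorem omegaRot_add (P Q : W.toAffine.Point) : θ (P + Q) = θ P + θ Q := by
  obtain ⟨θ', hθ'⟩ := exists_omegaRot hω h1 h2 h3 h4
  have hagree : ∀ R : W.toAffine.Point, θ R = θ' R := by
    intro R
    rcases R with _ | ⟨x, y, h⟩
    · rw [← Affine.Point.zero_def, hθ0, _root_.map_zero]
    · rw [hθ, hθ']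
  rw [hagree, hagree, hagree, map_add]

/-- `θ (n • P) = n • θ P` for `n : ℤ`. [folklore] -/
theorem omegaRot_zsmul (n : ℤ) (P : W.toAffine.Point) : θ (n • P) = n • θ P :=
  map_zsmul (AddMonoidHom.mk' θ (omegaRot_add hω h1 h2 h3 h4 hθ0 hθ)) n P

/-- `θ (−P) = −θ P`. [folklore] -/
theorem omegaRot_neg (P : W.toAffine.Point) : θ (-P) = -θ P :=
  map_neg (AddMonoidHom.mk' θ (omegaRot_add hω h1 h2 h3 h4 hθ0 hθ)) P

/-- `θ` preserves torsion. [folklore] -/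
theorem isOfFinAddOrder_omegaRot {T : W.toAffine.Point} (hT : IsOfFinAddOrder T) :
    IsOfFinAddOrder (θ T) :=
  (AddMonoidHom.mk' θ (omegaRot_add hω h1 h2 h3 h4 hθ0 hθ)).isOfFinAddOrder hT

/-- `θ(θP) = −P − θP` (`1 + ω + ω² = 0` in `End E`; from x1b's
`omegaRot_omegaRot_add_omegaRot_add`, `ω ≠ 1` in characteristic `≠ 3` supplied as `hω1`).
[cite: HuShuYin2019, p. 4] -/
theorem omegaRot_omegaRot (hω1 : ω ≠ 1) (P : W.toAffine.Point) : θ (θ P) = -P - θ P := by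
  have h := omegaRot_omegaRot_add_omegaRot_add hω h1 h2 h3 h4 hθ0 hθ hω1 P
  rw [add_assoc, add_eq_zero_iff_eq_neg] at h
  rw [h]; abel

end Theta

/-! ## §2 The mod-2 unit trick: `2` is inert in `ℤ[ω]` -/

section UnitTrick

variable {F : Type*} [Field F] {W : WeierstrassCurve F} {ω : F}
variable (hω : ω ^ 2 + ω + 1 = 0) (h1 : W.a₁ = 0) (h2 : W.a₂ = 0) (h3 : W.a₃ = 0) (h4 : W.a₄ = 0)
variable {θ : W.toAffine.Point → W.toAffine.Point} (hθ0 : θ 0 = 0)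
  (hθ : ∀ (x y : F) (h : W.toAffine.Nonsingular x y),
    θ (.some x y h) = .some (ω * x) y (nonsingular_omega_mul hω h1 h2 h3 h4 h))

/-- Core case `(a, b) ≡ (1, 0) (mod 2)`: from `a·P + b·θP = 2·Z + T` with `a` odd, `b` even,
`P = 2·(Z − a′·P − b′·θP) + T`. [folklore] -/
theorem exists_eq_two_smul_add_of_odd_even {P Z T : W.toAffine.Point} {a b : ℤ}
    (h : a • P + b • θ P = (2 : ℤ) • Z + T) (ha : ¬ (2 : ℤ) ∣ a) (hb : (2 : ℤ) ∣ b) :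
    ∃ Z' : W.toAffine.Point, P = (2 : ℤ) • Z' + T := by
  obtain ⟨b', rfl⟩ := hb
  obtain ⟨a', ha'⟩ : ∃ a', a = 2 * a' + 1 := by
    rcases Int.emod_two_eq_zero_or_one a with h0 | h1'
    · exact absurd (Int.dvd_of_emod_eq_zero h0) ha
    · exact ⟨a / 2, by omega⟩
  subst ha'
  refine ⟨Z - a' • P - b' • θ P, ?_⟩
  have e : (2 * a' + 1) • P + (2 * b') • θ P = (2 : ℤ) • (a' • P + b' • θ P) + P := by
    rw [add_smul, one_smul, mul_smul, mul_smul, smul_add]; abel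
  rw [e] at h
  calc P = ((2 : ℤ) • Z + T) - (2 : ℤ) • (a' • P + b' • θ P) := eq_sub_of_add_eq' h
    _ = (2 : ℤ) • (Z - a' • P - b' • θ P) + T := by
      rw [smul_sub, smul_sub, smul_add]; abel

include hω h1 h2 h3 h4 hθ0 hθ

/-- **The mod-`2` unit trick.** If `a·P + b·θP ∈ 2·W(F) + tors` and `a`, `b` are not both even,
then `P ∈ 2·W(F) + tors`: `a + bω` is a unit of `ℤ[ω]/2 = 𝔽₄` (the three cases
`(1,0)`, `(0,1) ↦` use `X + θX = (a − b)·P + a·θP`, `(1,1) ↦` use `θX = −b·P + (a − b)·θP`).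
[folklore] -/
theorem exists_eq_two_smul_add_torsion (hω1 : ω ≠ 1) {P Z T : W.toAffine.Point}
    (hT : IsOfFinAddOrder T) {a b : ℤ} (h : a • P + b • θ P = (2 : ℤ) • Z + T)
    (hab : ¬ ((2 : ℤ) ∣ a ∧ (2 : ℤ) ∣ b)) :
    ∃ Z' T' : W.toAffine.Point, IsOfFinAddOrder T' ∧ P = (2 : ℤ) • Z' + T' := by
  have hθθ := omegaRot_omegaRot hω h1 h2 h3 h4 hθ0 hθ hω1
  -- `θX = −b·P + (a − b)·θP`
  have hθX : θ (a • P + b • θ P) = (-b) • P + (a - b) • θ P := by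
    rw [omegaRot_add hω h1 h2 h3 h4 hθ0 hθ, omegaRot_zsmul hω h1 h2 h3 h4 hθ0 hθ,
      omegaRot_zsmul hω h1 h2 h3 h4 hθ0 hθ, hθθ]
    simp only [sub_smul, neg_smul, smul_sub, smul_neg]
    abel
  have hθrhs : θ ((2 : ℤ) • Z + T) = (2 : ℤ) • θ Z + θ T := by
    rw [omegaRot_add hω h1 h2 h3 h4 hθ0 hθ, omegaRot_zsmul hω h1 h2 h3 h4 hθ0 hθ]
  have hθT : IsOfFinAddOrder (θ T) := isOfFinAddOrder_omegaRot hω h1 h2 h3 h4 hθ0 hθ hT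
  by_cases ha : (2 : ℤ) ∣ a
  · -- then `b` is odd
    have hb : ¬ (2 : ℤ) ∣ b := fun hb => hab ⟨ha, hb⟩
    by_cases hab' : (2 : ℤ) ∣ (a - b)
    · -- impossible: `a` even and `a − b` even force `b` even
      have hb' : (2 : ℤ) ∣ a - (a - b) := dvd_sub ha hab'
      rw [sub_sub_cancel] at hb'
      exact absurd hb' hb
    · -- `(a, b) ≡ (0, 1)`: use `X + θX = (a − b)·P + a·θP` with `a − b` odd, `a` even
      have hsum : (a - b) • P + a • θ P = (2 : ℤ) • (Z + θ Z) + (T + θ T) := by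
        have e : (a - b) • P + a • θ P = (a • P + b • θ P) + θ (a • P + b • θ P) := by
          rw [hθX]; simp only [sub_smul, neg_smul]; abel
        rw [e, h, hθrhs, smul_add]; abel
      obtain ⟨Z', hZ'⟩ := exists_eq_two_smul_add_of_odd_even hsum hab' ha
      exact ⟨Z', T + θ T, hT.add hθT, hZ'⟩
  · by_cases hb : (2 : ℤ) ∣ b
    · -- `(a, b) ≡ (1, 0)`
      obtain ⟨Z', hZ'⟩ := exists_eq_two_smul_add_of_odd_even h ha hb
      exact ⟨Z', T, hT, hZ'⟩
    · -- `(a, b) ≡ (1, 1)`: use `θX = −b·P + (a − b)·θP` with `−b` odd, `a − b` even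
      have hab' : (2 : ℤ) ∣ (a - b) := by
        rcases Int.emod_two_eq_zero_or_one a with h0 | h0
        · exact absurd (Int.dvd_of_emod_eq_zero h0) ha
        rcases Int.emod_two_eq_zero_or_one b with h0' | h0'
        · exact absurd (Int.dvd_of_emod_eq_zero h0') hb
        exact Int.dvd_of_emod_eq_zero (by omega)
      have hθX' : (-b) • P + (a - b) • θ P = (2 : ℤ) • θ Z + θ T := by rw [← hθX, h, hθrhs]
      have hnb : ¬ (2 : ℤ) ∣ (-b) := fun hnb => hb ((Int.dvd_neg).mp hnb)
      obtain ⟨Z', hZ'⟩ := exists_eq_two_smul_add_of_odd_even hθX' hnb hab'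
      exact ⟨Z', θ T, hθT, hZ'⟩

end UnitTrick

/-! ## §3 `2`-primitive descent: the `ℤ₂[ω]`-coordinate of a point along a non-halvable `P` -/

section Descent

variable {F : Type*} [Field F] {W : WeierstrassCurve F} {ω : F}
variable (hω : ω ^ 2 + ω + 1 = 0) (h1 : W.a₁ = 0) (h2 : W.a₂ = 0) (h3 : W.a₃ = 0) (h4 : W.a₄ = 0)
variable {θ : W.toAffine.Point → W.toAffine.Point} (hθ0 : θ 0 = 0)
  (hθ : ∀ (x y : F) (h : W.toAffine.Nonsingular x y),
    θ (.some x y h) = .some (ω * x) y (nonsingular_omega_mul hω h1 h2 h3 h4 h))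

/-- `ord₂((a² − ab + b²)/n²) ≥ 0` when `n` is odd. [folklore] -/
theorem padicValRat_two_norm_div_sq_nonneg_of_odd {a b n : ℤ} (hn : ¬ (2 : ℤ) ∣ n) :
    0 ≤ padicValRat 2 (((a ^ 2 - a * b + b ^ 2 : ℤ) : ℚ) / ((n : ℚ) ^ 2)) := by
  have hn0 : n ≠ 0 := fun h => hn (h ▸ dvd_zero 2)
  by_cases hN : (a ^ 2 - a * b + b ^ 2 : ℤ) = 0
  · rw [hN]; simp
  have hvn : padicValRat 2 (n : ℚ) = 0 := by
    rw [padicValRat.of_int, padicValInt.eq_zero_of_not_dvd hn]; rfl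
  rw [padicValRat.div (by exact_mod_cast hN) (pow_ne_zero 2 (by exact_mod_cast hn0)),
    padicValRat.pow, hvn, mul_zero, sub_zero, padicValRat.of_int]
  exact_mod_cast Nat.zero_le _

include hω h1 h2 h3 h4 hθ0 hθ

/-- **`2`-PRIMITIVE DESCENT.** On a Mordell equation over a field with `ω` (`ω² + ω + 1 = 0`,
`ω ≠ 1`), let `P` be NOT of the form `2·Z + T` with `T` torsion. If `n·Y = a·P + b·θP + T` with
`n ≠ 0` and `T` torsion — i.e. `Y = ((a + bω)/n) ⊗ P` in `W(F) ⊗ ℚ` — then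
`0 ≤ ord₂((a² − ab + b²)/n²)`: the coordinate `(a + bω)/n` is `2`-INTEGRAL in `ℚ₂(ω)`. Proof by
strong induction on `|n|`: for `n` even the unit trick (§2) forces `a, b` even and one halves
(`2X` torsion ⇒ `X` torsion). This is the kernel form of MEMO bsd-cm-two §15.1 (odd-index lemma)
in the weak form the crux needs. [cite: HuShuYin2019, p. 8 (`K ⊗_{𝒪_K} E_p(K) ≃ K`)] -/
theorem padicValRat_two_norm_div_sq_nonneg (hω1 : ω ≠ 1) {P : W.toAffine.Point}
    (hP : ∀ Z T : W.toAffine.Point, IsOfFinAddOrder T → P ≠ (2 : ℤ) • Z + T) :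
    ∀ (k : ℕ) {Y T : W.toAffine.Point} {n a b : ℤ}, n.natAbs ≤ k → n ≠ 0 → IsOfFinAddOrder T →
      n • Y = a • P + b • θ P + T →
      0 ≤ padicValRat 2 (((a ^ 2 - a * b + b ^ 2 : ℤ) : ℚ) / ((n : ℚ) ^ 2)) := by
  intro k
  induction k with
  | zero =>
    intro Y T n a b hk hn
    exact absurd (Int.natAbs_eq_zero.mp (Nat.le_zero.mp hk)) hn
  | succ k ih =>
    intro Y T n a b hk hn hT hY
    by_cases h2n : (2 : ℤ) ∣ n
    · obtain ⟨n', rfl⟩ := h2n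
      have hn' : n' ≠ 0 := by rintro rfl; exact hn (by ring)
      -- `a·P + b·θP = 2·(n'·Y) + (−T)`
      have hrel : a • P + b • θ P = (2 : ℤ) • (n' • Y) + (-T) := by
        rw [← mul_smul, hY]; abel
      have hab : (2 : ℤ) ∣ a ∧ (2 : ℤ) ∣ b := by
        by_contra hab
        obtain ⟨Z', T', hT', hP'⟩ :=
          exists_eq_two_smul_add_torsion hω h1 h2 h3 h4 hθ0 hθ hω1 hT.neg hrel hab
        exact hP Z' T' hT' hP'
      obtain ⟨⟨a', rfl⟩, ⟨b', rfl⟩⟩ := hab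
      -- halve: `2·(n'·Y − a'·P − b'·θP) = T` is torsion, hence so is `n'·Y − a'·P − b'·θP`
      have htwice : (2 : ℤ) • (n' • Y - a' • P - b' • θ P) = T := by
        calc (2 : ℤ) • (n' • Y - a' • P - b' • θ P)
            = (2 * n') • Y - (2 * a') • P - (2 * b') • θ P := by
              rw [smul_sub, smul_sub, ← mul_smul, ← mul_smul, ← mul_smul]
          _ = T := by rw [hY]; abel
      have hT' : IsOfFinAddOrder (n' • Y - a' • P - b' • θ P) :=
        Literature.NumberTheory.EllipticCurves.isOfFinAddOrder_of_zsmul two_ne_zero (htwice ▸ hT)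
      have hY' : n' • Y = a' • P + b' • θ P + (n' • Y - a' • P - b' • θ P) := by abel
      have hk' : n'.natAbs ≤ k := by
        have : (2 * n').natAbs = 2 * n'.natAbs := by rw [Int.natAbs_mul]; rfl
        have hpos : 0 < n'.natAbs := Int.natAbs_pos.mpr hn'
        omega
      have hih := ih hk' hn' hT' hY'
      -- same rational number
      have e : (((2 * a') ^ 2 - 2 * a' * (2 * b') + (2 * b') ^ 2 : ℤ) : ℚ) / (((2 * n' : ℤ) : ℚ) ^ 2)
          = ((a' ^ 2 - a' * b' + b' ^ 2 : ℤ) : ℚ) / ((n' : ℚ) ^ 2) := by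
        have hn'Q : (n' : ℚ) ≠ 0 := by exact_mod_cast hn'
        push_cast
        field_simp
      rw [e]
      exact hih
    · exact padicValRat_two_norm_div_sq_nonneg_of_odd h2n

end Descent

end Summit.BirchSwinnertonDyer.BirchSwinnertonDyer.Theorems.SylvesterTwoNonneg

end
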